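import Literature.AlgebraicGeometry.Frobenioids.Prop55SubStandardClosers
import Literature.AlgebraicGeometry.Frobenioids.RealificationNonDilating
import Literature.AlgebraicGeometry.Frobenioids.ModelFrobenioidNoAnchors
import Literature.AlgebraicGeometry.Frobenioids.Prop55iiiRlfModel
import HarnessLib

/-!
# Frobenioids I, Proposition 5.5 (iii), "Finally" (standard type) — the slot
# `Prop55iii_untr_rlf_standard` PROVED

Mochizuki, *The geometry of Frobenioids I: the general theory*, Kyushu J. Math. **62** (2008)
293–400, §5, Proposition 5.5 (iii) p. 104 ll. 37–39 ("Finally, if, moreover, `C` is not of group-like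
type, then if `C` is of standard (respectively, rationally standard) type, then so are `C^un-tr`,
`C^rlf`"), proof p. 105 ll. 22–27. [cite: MochizukiFrdI2008, Prop. 5.5 (iii) p.104]

Proof-only closer (cell abc-iut, sub-DAG S7 row `FrdI:Prop5.5(iii)/P55-L07`, standard-type half, seat
abc-iut-w4-d084) of the named statement `FrdI.Prop55Sub.Prop55iii_untr_rlf_standard F hF hΦ`
(`Prop55Sub.lean`), UNCONDITIONALLY:
* the `C^un-tr` conjunct is `PreFrobenioid.isOfStandardType_untr'` (`UnitTrivializationStandardTypeProofs.lean`);
* the `C^rlf` conjunct: `C^rlf` is, by construction, the model category of `(Φ^rlf, ℝ · Φ^birat)`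
  (`FrobenioidRealificationCanonical.lean`), so Def. 3.1 (i) is checked clause by clause through Thm. 5.2
  (iii) right-to-left in the form `ModelFrobenioid.data_isOfStandardType_of` (`ModelFrobenioidNoAnchors.lean`),
  which needs only: `Φ^rlf` sharp (`IsPerfFactorial.Rlf.isSharp`), `ℝ · Φ^birat` group-like
  (`RealificationData.realSpan_toMonoid_isGroupLike`), `D` totally epimorphic (part of "`C` is a
  Frobenioid"), (a) vacuous — `Φ^rlf` is not the zero monoid since `C` is not of group-like type and
  `Φ → Φ^rlf` is injective (`not_isZeroMonoid_rlfFunctor_of_not_groupLike`), (b) `D` of FSMFF-type (from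
  "`C` of standard type"), (c) `Φ^rlf` non-dilating because `Φ` is (`isNonDilatingOn_rlfFunctor`,
  `RealificationNonDilating.lean`; print p. 105 l. 26).
In particular the standing hypotheses of Thm. 5.2 for the realified data ("`Φ^rlf` is a monoid on `D`",
Prop. 5.3 — NOT available in the tree's generality, cell finding P53-F1) are not needed for this half.
The slot's antecedents "Frobenius-isotropic / Frobenius-normalized type" are not used. No statement of
the paper is strengthened in its conclusion; nothing here bears on [IUTchIII] Cor. 3.12.
-/

noncomputable section

namespace Literature.AlgebraicGeometry.Frobenioids

open CategoryTheory Opposite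

universe w v v' u u'

namespace PreFrobenioid

variable {D : Type u} [Category.{v} D] {Φ : Dᵒᵖ ⥤ CommMonCat.{w}} {C : Type u'}
  [Category.{v'} C] (F : C ⥤ ElemFrobenioid Φ)

open PreFrobenioidData (ofFunctor)
open Literature.AnabelianGeometry.EtaleTheta (rlfFunctor)

/-- **THE realification `C^rlf` is of standard type** as soon as `D` is totally epimorphic and of
FSMFF-type, `Φ^rlf` is not the zero monoid and `Φ^rlf` is non-dilating (Thm. 5.2 (iii) right to left for
the model category of `(Φ^rlf, ℝ · Φ^birat)`, clause (a) vacuous; no "monoid on `D`" hypothesis).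
[cite: MochizukiFrdI2008, Prop. 5.5 (iii) p.104] -/
theorem isOfStandardType_rlf (hΦ : IsPerfFactorialOn Φ) (hD : IsTotallyEpimorphic D)
    (hnz : ¬ ModelFrobenioid.IsZeroMonoid (rlfFunctor Φ (IsPerfFactorialOn.op hΦ)))
    (hfs : IsOfFSMFFType D) (hnd : IsNonDilatingOn (rlfFunctor Φ (IsPerfFactorialOn.op hΦ))) :
    (ofFunctor _ (rlfToElem F hΦ)).IsOfStandardType :=
  ModelFrobenioid.data_isOfStandardType_of _ _ _
    (RealificationData.realSpan_toMonoid_isGroupLike _ _)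
    (fun X => IsPerfFactorial.Rlf.isSharp (IsPerfFactorialOn.op hΦ (op X))) hD
    (fun h0 => (hnz h0).elim) hfs hnd

/-- **`C` of standard type and not of group-like type ⇒ `C^rlf` of standard type** (Prop. 5.5 (iii),
"Finally", the `C^rlf` half; `C` a Frobenioid over a perf-factorial `Φ`). [cite: MochizukiFrdI2008, Prop. 5.5 (iii) p.104] -/
theorem isOfStandardType_rlf_of_isOfStandardType (hF : IsFrobenioid F) (hΦ : IsPerfFactorialOn Φ)
    (hng : ¬ IsOfType (IsGroupLikeObj F)) (hS : (ofFunctor Φ F).IsOfStandardType) :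
    (ofFunctor _ (rlfToElem F hΦ)).IsOfStandardType :=
  isOfStandardType_rlf F hΦ hF.isPreFrobenioid.isTotallyEpimorphic_base
    (not_isZeroMonoid_rlfFunctor_of_not_groupLike F hΦ hng) hS.fsmff
    (isNonDilatingOn_rlfFunctor Φ (IsPerfFactorialOn.op hΦ)
      -- the statement files' `IsNonDilatingOn` (conclusion `∀ a, α^char a = a`) ⇒ found's (`α^char = id`)
      fun X f hle => MonoidHom.ext (hS.nonDilating.nonDilating X f hle))

end PreFrobenioid

namespace FrdI.Prop55Sub

open PreFrobenioid

variable {D : Type u} [Category.{v} D] {Φ : Dᵒᵖ ⥤ CommMonCat.{w}} {C : Type u'}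
  [Category.{v'} C] (F : C ⥤ ElemFrobenioid Φ)

/-- **Proposition 5.5 (iii), "Finally", standard type — the slot `Prop55iii_untr_rlf_standard` PROVED**:
for a Frobenioid `C` over a perf-factorial `Φ`, NOT of group-like type and of standard type, both `C^un-tr`
and `C^rlf` are of standard type. (The slot's further antecedents — Frobenius-isotropic and
Frobenius-normalized type — are not used.) [cite: MochizukiFrdI2008, Prop. 5.5 (iii) p.104] -/
theorem prop55iii_untr_rlf_standard_holds (hF : IsFrobenioid F) (hΦ : IsPerfFactorialOn Φ) :
    Prop55iii_untr_rlf_standard F hF hΦ := fun _ _ hng hS =>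
  ⟨isOfStandardType_untr' hF hng hS, isOfStandardType_rlf_of_isOfStandardType F hF hΦ hng hS⟩

end FrdI.Prop55Sub

end Literature.AlgebraicGeometry.Frobenioids
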